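import Literature.Analysis.FluidPDE.KNSSMildDecayHorizontal
import Literature.Analysis.FluidPDE.KNSSWeakDriftMildProofs
import Literature.Analysis.FluidPDE.ClassicalBoundedWeak
import Literature.Analysis.FluidPDE.NSBoundedMildSmoothing
import Literature.Analysis.FluidPDE.NSBoundedMildOseenIntegral
import Literature.Analysis.UnboundedOperators.HeatKernelGaussianData
import HarnessLib

/-!
# KNSS 2009, Theorem 6.1, mildness clause — II: discharge of `KNSS2009_mild_of_rMulNorm_bounded`,
# and the vertex fact of Theorem 6.2

Analysis/FluidPDE proofs file (everything proved; no named facts). It **discharges the named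
fact** `Literature.Analysis.FluidPDE.KNSS2009_mild_of_rMulNorm_bounded` (`KNSSMildDecay.lean`;
Koch–Nadirashvili–Seregin–Šverák, Acta Math. 203 (2009) = arXiv:0709.3599, Theorem 6.1, mildness
clause, proof p. 12, last paragraph) and, through the proved reduction
`KNSS2009_typeI_rate_vertex_of_mild` (`KNSSTypeIRateVertexProofs.lean`), the named fact
`Literature.Analysis.FluidPDE.KNSS2009_typeI_rate_vertex` (`KNSSTypeIRateCore.lean`; proof of
Theorem 6.2, last paragraph, p. 13):

* `KNSS2009_mild_of_rMulNorm_bounded_holds : KNSS2009_mild_of_rMulNorm_bounded`;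
* `KNSS2009_typeI_rate_vertex_holds : KNSS2009_typeI_rate_vertex`.

## The proof of the mildness clause

Let `(u, p)` be classical on `ℝ³ × (a, b)`, bounded by `L` on `(a, T]` with `|x'| ‖u‖ ≤ D`
there, and let `a < s < t ≤ T`.

1. *Open window.* Assume first `t < T`. Translate time by `a₁ = (a + s)/2`: `ũ(r) = u(r + a₁)`
   is classical on `(0, T₁)`, `T₁ = T - a₁`, bounded by `L`, hence a bounded weak solution there
   (`IsClassicalNSSolutionOn.isBoundedWeakNSSolutionOn`), and **Lemma 3.1**
   (`KNSS2009_weak_driftMild_holds`) gives `ũ(r) = U(r) + b(r)` a.e. for a.e. `r` (the *good*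
   times `G`, of full measure), with `U(t') = e^{(t'-r)Δ}U(r) - driftDuhamel U b r t'`.
2. *The representation with drift.* For `r ∈ G` and `r < t' < T₁`,
   `U(t') = R_r(t') - b(r)` everywhere, where `R_r(t') = e^{(t'-r)Δ}ũ(r) - B¹_r(ũ, ũ)(t')` is the
   drift-free right-hand side: `e^{τΔ}(ũ(r) - b(r)) = e^{τΔ}ũ(r) - b(r)` and the drift bridge
   `driftDuhamel U b r t' = B¹_r(U + b, U + b)(t') = B¹_r(ũ, ũ)(t')`
   (`driftDuhamel_eq_oseenDuhamel_drift`, `oseenDuhamel_congr_ae_slices`).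
3. *The drift is constant on `G`* ("`b` must vanish"): for `r₁ < r₂` in `G` and `t' > r₂`,
   `b(r₂) - b(r₁) = R_{r₂}(t')(y) - R_{r₁}(t')(y)` for every `y`, and both `R`'s tend to `0` as
   `|y'| → ∞` (`exists_forall_norm_heatExtension_le_of_cylRadius`,
   `exists_forall_norm_oseenDuhamel_le_of_cylRadius`: the decay (6.2) propagates).
4. *Good pairs.* For `r < t'` both in `G`: `ũ(t') = U(t') + b(t') = R_r(t')` a.e., hence
   everywhere (both sides are continuous: `continuous_oseenDuhamel_slice`,
   `contDiff_heatExtension_holds`).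
5. *All pairs* `0 < r < t' < T₁` by density of `G` and continuity: in `t'` (continuity of `ũ`,
   of the caloric term, `hasDerivAt_heatExtension_time`, and of the Duhamel term,
   `exists_forall_norm_oseenDuhamel_sub_le`) and in `r` (`continuousAt_heatExtension_datum`,
   `continuousAt_oseenDuhamel_initialTime`). Translating back (`oseenDuhamel_translate`) gives the
   clause for `t < T`.
6. *The endpoint* `t = T` by continuity in `t` of `u`, of `e^{(t-s)Δ}u(s)` and of
   `B¹_s(u,u)(t)` (the latter needs `u` bounded on `(s, T)` only).

## References

* G. Koch, N. Nadirashvili, G. Seregin, V. Šverák, *Liouville theorems for the Navier–Stokes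
  equations and applications*, Acta Math. 203 (2009) 83–105 = arXiv:0709.3599 (arXiv pages):
  Theorem 6.1 and its proof, last paragraph, pp. 11–12; Lemma 3.1, p. 7; proof of Theorem 6.2,
  p. 13. [KochNadirashviliSereginSverak2009]
-/

noncomputable section

open MeasureTheory Set Function Filter TopologicalSpace InnerProductSpace Metric
open _root_.Topology
open scoped ENNReal NNReal RealInnerProductSpace

namespace Literature.Analysis.FluidPDE

/-! ### Two elementary lemmas -/

/-- A vector whose norm is at most every positive `ε` vanishes. [folklore] -/
theorem eq_zero_of_forall_norm_le {F : Type*} [NormedAddCommGroup F] {v : F}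
    (h : ∀ ε > 0, ‖v‖ ≤ ε) : v = 0 := by
  by_contra hv
  have hpos : 0 < ‖v‖ := norm_pos_iff.2 hv
  have := h (‖v‖ / 2) (by positivity)
  linarith

/-- A set of times of full measure in `(0, T₁)` meets every nonempty open subinterval.
[folklore] -/
theorem exists_mem_Ioo_of_ae_mem {G : Set ℝ} {T₁ : ℝ}
    (hG : ∀ᵐ r ∂((volume : Measure ℝ).restrict (Ioo 0 T₁)), r ∈ G) {r₁ r₂ : ℝ} (h0 : 0 ≤ r₁)
    (h12 : r₁ < r₂) (h2 : r₂ ≤ T₁) : ∃ r ∈ Ioo r₁ r₂, r ∈ G := by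
  have hsub : Ioo r₁ r₂ ⊆ Ioo 0 T₁ := Ioo_subset_Ioo h0 h2
  have hG' : ∀ᵐ r ∂((volume : Measure ℝ).restrict (Ioo r₁ r₂)), r ∈ G :=
    ae_restrict_of_ae_restrict_of_subset hsub hG
  have hmem : ∀ᵐ r ∂((volume : Measure ℝ).restrict (Ioo r₁ r₂)), r ∈ Ioo r₁ r₂ :=
    ae_restrict_mem measurableSet_Ioo
  haveI hne : (ae ((volume : Measure ℝ).restrict (Ioo r₁ r₂))).NeBot := by
    rw [ae_neBot, Ne, Measure.restrict_eq_zero, Real.volume_Ioo]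
    exact (ENNReal.ofReal_pos.2 (sub_pos.2 h12)).ne'
  obtain ⟨r, hr1, hr2⟩ := (hmem.and hG').exists
  exact ⟨r, hr1, hr2⟩

/-! ### The mildness clause on the open window -/

section OpenWindow

/-- **The mildness clause of Theorem 6.1 for `t < T`** (KNSS 2009, proof of Thm 6.1, last
paragraph, via Lemma 3.1; module docstring, steps 1–5): a classical solution on `ℝ³ × (a, b)`,
bounded on `(a, T]` and satisfying (6.2) there, satisfies
`u(t) = e^{(t-s)Δ}u(s) - B¹_s(u,u)(t)` pointwise for all `a < s < t < T`. [cite: KochNadirashviliSereginSverak2009, Thm 6.1 (mildness clause), proof last paragraph (arXiv p. 12)] -/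
theorem mild_of_rMulNorm_bounded_of_lt
    {a b T : ℝ} {u : ℝ → EuclideanSpace ℝ (Fin 3) → EuclideanSpace ℝ (Fin 3)}
    {p : ℝ → EuclideanSpace ℝ (Fin 3) → ℝ} (hcl : IsClassicalNSSolutionOn (Ioo a b) 1 0 u p)
    (haT : a < T) (hTb : T < b) {L : ℝ} (hL : ∀ t ∈ Ioc a T, ∀ x, ‖u t x‖ ≤ L) {D : ℝ}
    (hD : ∀ t ∈ Ioc a T, ∀ x, cylRadius x * ‖u t x‖ ≤ D) {s t : ℝ} (has : a < s) (hst : s < t)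
    (htT : t < T) (x : EuclideanSpace ℝ (Fin 3)) :
    u t x = UnboundedOperators.heatExtension (u s) (t - s) x - oseenDuhamel 1 s u u t x := by
  -- ### Step 1: time translation and Lemma 3.1
  set a₁ : ℝ := (a + s) / 2 with ha₁
  have haa₁ : a < a₁ := by rw [ha₁]; linarith
  have ha₁s : a₁ < s := by rw [ha₁]; linarith
  set T₁ : ℝ := T - a₁ with hT₁
  have hT₁pos : 0 < T₁ := by rw [hT₁]; linarith
  set v : ℝ → EuclideanSpace ℝ (Fin 3) → EuclideanSpace ℝ (Fin 3) := fun r y => u (r + a₁) y with hv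
  set q : ℝ → EuclideanSpace ℝ (Fin 3) → ℝ := fun r y => p (r + a₁) y with hq
  have hL0 : 0 ≤ L := (norm_nonneg _).trans (hL T ⟨haT, le_rfl⟩ 0)
  have hD0 : 0 ≤ D := le_trans (mul_nonneg (cylRadius_nonneg _) (norm_nonneg _)) (hD T ⟨haT, le_rfl⟩ 0)
  -- `v` is classical on `(0, T₁)` (indeed on the translate of `(a, b)`)
  have hclv' : IsClassicalNSSolutionOn ((· + a₁) ⁻¹' Ioo a b) 1 0 v q := by
    have h := hcl.comp_add_right a₁
    exact h
  have hsubI : Ioo 0 T₁ ⊆ (· + a₁) ⁻¹' Ioo a b := by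
    intro r hr
    simp only [mem_preimage, mem_Ioo]
    constructor <;> [linarith [hr.1]; (rw [hT₁] at hr; linarith [hr.2])]
  have hclv : IsClassicalNSSolutionOn (Ioo 0 T₁) 1 0 v q := hclv'.mono hsubI (uniqueDiffOn_Ioo 0 T₁)
  -- bounds and decay for `v`
  have hmemIoc : ∀ r ∈ Ioo 0 T₁, r + a₁ ∈ Ioc a T := fun r hr =>
    ⟨by linarith [hr.1], by rw [hT₁] at hr; linarith [hr.2]⟩
  have hvL : ∀ r ∈ Ioo 0 T₁, ∀ y, ‖v r y‖ ≤ L := fun r hr y => hL _ (hmemIoc r hr) y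
  have hvD : ∀ r ∈ Ioo 0 T₁, ∀ y, cylRadius y * ‖v r y‖ ≤ D := fun r hr y => hD _ (hmemIoc r hr) y
  have hvdec : ∀ ε > 0, ∃ R : ℝ, ∀ r ∈ Ioo 0 T₁, ∀ y, R ≤ cylRadius y → ‖v r y‖ ≤ ε := by
    intro ε hε
    refine ⟨D / ε + 1, fun r hr y hy => ?_⟩
    have hρ : 0 < cylRadius y := lt_of_lt_of_le (by positivity) hy
    have h1 : ‖v r y‖ ≤ D / cylRadius y := by
      rw [le_div_iff₀ hρ, mul_comm]; exact hvD r hr y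
    have h2 : D / cylRadius y ≤ ε := by
      rw [div_le_iff₀ hρ]
      have : D ≤ ε * (D / ε + 1) := by
        rw [mul_add, mul_div_cancel₀ _ hε.ne', mul_one]; linarith
      exact this.trans (mul_le_mul_of_nonneg_left hy hε.le)
    exact h1.trans h2
  have hcontv : ContinuousOn (uncurry v) (Ioo 0 T₁ ×ˢ univ) := hclv.smooth_velocity.continuousOn
  have hcontv_slice : ∀ r ∈ Ioo 0 T₁, Continuous (v r) := fun r hr =>
    (hclv.contDiff_velocity hr).continuous
  have hmeasv : ∀ {s₁ s₂ : ℝ}, 0 ≤ s₁ → s₂ ≤ T₁ → AEStronglyMeasurable (uncurry v)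
      ((volume : Measure (ℝ × EuclideanSpace ℝ (Fin 3))).restrict (Ioo s₁ s₂ ×ˢ univ)) :=
    fun {s₁ s₂} h1 h2 => (hcontv.mono (prod_mono (Ioo_subset_Ioo h1 h2) subset_rfl)).aestronglyMeasurable
      (measurableSet_Ioo.prod MeasurableSet.univ)
  -- Lemma 3.1
  have hweak : IsBoundedWeakNSSolutionOn (Ioo 0 T₁) isOpen_Ioo 1 v :=
    hclv.isBoundedWeakNSSolutionOn ⟨L, hvL⟩
  obtain ⟨N, hN⟩ := KNSS2009_weak_driftMild_holds L T₁ hT₁pos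
  obtain ⟨U, bd, hUb, hae⟩ := hN hweak hvL
  -- the good times
  set G : Set ℝ := {r | r ∈ Ioo 0 T₁ ∧ v r =ᵐ[volume] fun y => U r y + bd r} with hGdef
  have hGae : ∀ᵐ r ∂((volume : Measure ℝ).restrict (Ioo 0 T₁)), r ∈ G := by
    filter_upwards [hae, ae_restrict_mem measurableSet_Ioo] with r h1 h2
    exact ⟨h2, h1⟩
  -- ### Step 2: the representation with drift at good initial times
  -- the drift-free right-hand side
  set R : ℝ → ℝ → EuclideanSpace ℝ (Fin 3) → EuclideanSpace ℝ (Fin 3) := fun r t' y =>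
    UnboundedOperators.heatExtension (v r) (t' - r) y - oseenDuhamel 1 r v v t' y with hRdef
  have hUslice : ∀ σ, Measurable (U σ) := fun σ =>
    hUb.measurable.comp (measurable_const.prodMk measurable_id)
  have hA : ∀ r ∈ G, ∀ t' : ℝ, r < t' → t' < T₁ → ∀ y, U t' y = R r t' y - bd r := by
    intro r hr t' hrt' ht' y
    have hr0 : 0 < r := hr.1.1
    have hmild := hUb.mild r t' hr0 hrt' ht' y
    -- the caloric term
    have hcal : UnboundedOperators.heatExtension (U r) (t' - r) y =
        UnboundedOperators.heatExtension (v r) (t' - r) y - bd r := by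
      have hae_r : U r =ᵐ[volume] fun z => v r z - bd r := by
        filter_upwards [hr.2] with z hz
        rw [hz]; abel
      rw [UnboundedOperators.heatExtension_congr_ae' hae_r,
        UnboundedOperators.heatExtension_sub_of_bound (hcontv_slice r hr.1) continuous_const
          (hvL r hr.1) (fun _ => le_rfl) (sub_pos.2 hrt') y,
        UnboundedOperators.heatExtension_const _ (sub_pos.2 hrt') y]
    -- the Duhamel term through the bridge and the a.e. identification of the slices
    have hduh : driftDuhamel U bd r t' y = oseenDuhamel 1 r v v t' y := by
      have hNN : ∀ σ ∈ Ioo r t', ∀ z, ‖U σ z + bd σ‖ ≤ N + N := fun σ hσ z =>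
        (norm_add_le _ _).trans (add_le_add (hUb.norm_le σ ⟨hr0.trans hσ.1, hσ.2.trans ht'⟩ z)
          (hUb.norm_drift_le σ))
      rw [driftDuhamel_eq_oseenDuhamel_drift (fun σ _ => hUslice σ) hNN hrt'.le y]
      refine oseenDuhamel_congr_ae_slices ?_ y
      have hsub : Ioo r t' ⊆ Ioo 0 T₁ := Ioo_subset_Ioo hr0.le ht'.le
      filter_upwards [ae_restrict_of_ae_restrict_of_subset hsub hae] with σ hσ
      exact hσ.symm
    rw [hmild, hcal, hduh]
    simp only [hRdef]
    abel
  -- ### Step 3: the drift is constant on the good times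
  -- decay of `R r t'` at horizontal infinity
  have hRdec : ∀ r ∈ Ioo 0 T₁, ∀ t' : ℝ, r < t' → t' ≤ T₁ → ∀ ε > 0, ∃ Rd : ℝ, ∀ y,
      Rd ≤ cylRadius y → ‖R r t' y‖ ≤ ε := by
    intro r hr t' hrt' ht' ε hε
    obtain ⟨R₁, hR₁⟩ := exists_forall_norm_heatExtension_le_of_cylRadius
      (hcontv_slice r hr).aestronglyMeasurable (hvL r hr)
      (fun ε' hε' => by
        obtain ⟨Rr, hRr⟩ := hvdec ε' hε'
        exact ⟨Rr, fun z hz => hRr r hr z hz⟩)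
      (sub_pos.2 hrt') (half_pos hε)
    obtain ⟨R₂, hR₂⟩ := exists_forall_norm_oseenDuhamel_le_of_cylRadius hcontv hr.1.le ht' hrt' hL0
      (fun τ hτ y => hvL τ ⟨hr.1.trans hτ.1, hτ.2.trans_le ht'⟩ y)
      (fun ε' hε' => by
        obtain ⟨Rr, hRr⟩ := hvdec ε' hε'
        exact ⟨Rr, fun τ hτ z hz => hRr τ ⟨hr.1.trans hτ.1, hτ.2.trans_le ht'⟩ z hz⟩)
      (half_pos hε)
    refine ⟨max R₁ R₂, fun y hy => ?_⟩
    calc ‖R r t' y‖ ≤ ‖UnboundedOperators.heatExtension (v r) (t' - r) y‖ + ‖oseenDuhamel 1 r v v t' y‖ :=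
          norm_sub_le _ _
      _ ≤ ε / 2 + ε / 2 := add_le_add (hR₁ y ((le_max_left _ _).trans hy)) (hR₂ y ((le_max_right _ _).trans hy))
      _ = ε := by ring
  -- points with prescribed large `|y'|`
  have hfar : ∀ Rd : ℝ, ∃ y : EuclideanSpace ℝ (Fin 3), Rd ≤ cylRadius y := by
    intro Rd
    refine ⟨EuclideanSpace.single 0 (max Rd 0), ?_⟩
    have : cylRadius (EuclideanSpace.single 0 (max Rd 0) : EuclideanSpace ℝ (Fin 3)) = max Rd 0 := by
      unfold cylRadius
      simp [Real.sqrt_sq (le_max_right Rd 0)]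
    rw [this]; exact le_max_left _ _
  have hB_lt : ∀ r₁ ∈ G, ∀ r₂ ∈ G, r₁ < r₂ → bd r₁ = bd r₂ := by
    intro r₁ hr₁ r₂ hr₂ h12
    set t' : ℝ := (r₂ + T₁) / 2 with ht'
    have h2t' : r₂ < t' := by rw [ht']; linarith [hr₂.1.2]
    have ht'T : t' < T₁ := by rw [ht']; linarith [hr₂.1.2]
    have h1t' : r₁ < t' := h12.trans h2t'
    have key : ∀ y, bd r₂ - bd r₁ = R r₂ t' y - R r₁ t' y := by
      intro y
      have e1 := hA r₁ hr₁ t' h1t' ht'T y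
      have e2 := hA r₂ hr₂ t' h2t' ht'T y
      rw [e1] at e2
      -- `e2 : R r₁ t' y - bd r₁ = R r₂ t' y - bd r₂`
      calc bd r₂ - bd r₁ = (R r₂ t' y - (R r₂ t' y - bd r₂)) - (R r₁ t' y - (R r₁ t' y - bd r₁)) := by abel
        _ = (R r₂ t' y - (R r₁ t' y - bd r₁)) - (R r₁ t' y - (R r₁ t' y - bd r₁)) := by rw [← e2]
        _ = R r₂ t' y - R r₁ t' y := by abel
    have hzero : bd r₂ - bd r₁ = 0 := by
      refine eq_zero_of_forall_norm_le fun ε hε => ?_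
      obtain ⟨Ra, hRa⟩ := hRdec r₁ hr₁.1 t' h1t' ht'T.le (ε / 2) (half_pos hε)
      obtain ⟨Rb, hRb⟩ := hRdec r₂ hr₂.1 t' h2t' ht'T.le (ε / 2) (half_pos hε)
      obtain ⟨y, hy⟩ := hfar (max Ra Rb)
      rw [key y]
      calc ‖R r₂ t' y - R r₁ t' y‖ ≤ ‖R r₂ t' y‖ + ‖R r₁ t' y‖ := norm_sub_le _ _
        _ ≤ ε / 2 + ε / 2 := add_le_add (hRb y ((le_max_right _ _).trans hy))
            (hRa y ((le_max_left _ _).trans hy))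
        _ = ε := by ring
    exact (sub_eq_zero.1 hzero).symm
  have hB : ∀ r₁ ∈ G, ∀ r₂ ∈ G, bd r₁ = bd r₂ := by
    intro r₁ hr₁ r₂ hr₂
    rcases lt_trichotomy r₁ r₂ with h | h | h
    · exact hB_lt r₁ hr₁ r₂ hr₂ h
    · rw [h]
    · exact (hB_lt r₂ hr₂ r₁ hr₁ h).symm
  -- ### Step 4: good pairs
  -- continuity of the drift-free right-hand side in `y`
  have hRcont : ∀ r ∈ Ioo 0 T₁, ∀ t' : ℝ, r < t' → t' ≤ T₁ → Continuous (R r t') := by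
    intro r hr t' hrt' ht'
    have h1 : Continuous (UnboundedOperators.heatExtension (v r) (t' - r)) :=
      (UnboundedOperators.contDiff_heatExtension_holds
        (UnboundedOperators.memLp_top_of_continuous_of_bound (hcontv_slice r hr) (hvL r hr)) le_top
        (sub_pos.2 hrt')).continuous
    have h2 : Continuous (oseenDuhamel 1 r v v t') :=
      continuous_oseenDuhamel_slice one_pos hL0 (hmeasv hr.1.le ht') (hmeasv hr.1.le ht')
        (fun τ hτ y => hvL τ ⟨hr.1.trans hτ.1, hτ.2.trans_le ht'⟩ y)
        (fun τ hτ y => hvL τ ⟨hr.1.trans hτ.1, hτ.2.trans_le ht'⟩ y) hrt' le_rfl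
    exact h1.sub h2
  have hC : ∀ r ∈ G, ∀ t' ∈ G, r < t' → ∀ y, v t' y = R r t' y := by
    intro r hr t' ht' hrt' y
    have hae' : v t' =ᵐ[volume] R r t' := by
      filter_upwards [ht'.2] with z hz
      rw [hz, hA r hr t' hrt' ht'.1.2 z, hB t' ht' r hr]
      abel
    have heq := (Continuous.ae_eq_iff_eq volume (hcontv_slice t' ht'.1) (hRcont r hr.1 t' hrt' ht'.1.2.le)).1 hae'
    exact congrFun heq y
  -- ### Step 5: all pairs
  -- (a) good initial time, any later time
  have hC' : ∀ r ∈ G, ∀ t' : ℝ, r < t' → t' < T₁ → ∀ y, v t' y = R r t' y := by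
    intro r hr t' hrt' ht'T y
    have hr0 : 0 < r := hr.1.1
    have hsub : v t' y - R r t' y = 0 := by
      refine eq_zero_of_forall_norm_le fun ε hε => ?_
      -- continuity of `v` in time at `(t', y)`
      have hvc : ContinuousAt (fun σ => v σ y) t' := by
        have hc : ContinuousAt (uncurry v) (t', y) :=
          hcontv.continuousAt ((isOpen_Ioo.prod isOpen_univ).mem_nhds ⟨⟨hr0.trans hrt', ht'T⟩, mem_univ _⟩)
        have hg : ContinuousAt (fun σ : ℝ => (σ, y)) t' :=
          (continuous_id.prodMk continuous_const).continuousAt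
        exact ContinuousAt.comp (g := uncurry v) (f := fun σ : ℝ => (σ, y)) hc hg
      have e1 : ∀ᶠ σ in 𝓝 t', ‖v σ y - v t' y‖ < ε / 3 := by
        have := (Metric.tendsto_nhds.1 hvc) (ε / 3) (by positivity)
        simpa only [dist_eq_norm] using this
      -- continuity of the caloric term in time
      have hcalc : ContinuousAt (fun σ => UnboundedOperators.heatExtension (v r) (σ - r) y) t' := by
        have hd := UnboundedOperators.hasDerivAt_heatExtension_time (sub_pos.2 hrt')
          (UnboundedOperators.memLp_top_of_continuous_of_bound (hcontv_slice r hr.1) (hvL r hr.1)) le_top y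
        have hg : ContinuousAt (fun σ : ℝ => σ - r) t' := (continuous_id.sub continuous_const).continuousAt
        exact ContinuousAt.comp (g := fun σ => UnboundedOperators.heatExtension (v r) σ y)
          (f := fun σ : ℝ => σ - r) hd.continuousAt hg
      have e2 : ∀ᶠ σ in 𝓝 t', ‖UnboundedOperators.heatExtension (v r) (σ - r) y -
          UnboundedOperators.heatExtension (v r) (t' - r) y‖ < ε / 3 := by
        have := (Metric.tendsto_nhds.1 hcalc) (ε / 3) (by positivity)
        simpa only [dist_eq_norm] using this
      -- continuity of the Duhamel term in time (uniform modulus)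
      obtain ⟨δ, hδ, hmod⟩ := exists_forall_norm_oseenDuhamel_sub_le (E := EuclideanSpace ℝ (Fin 3))
        one_pos hT₁pos hL0 (by positivity : (0 : ℝ) < ε / 3)
      have e3 : ∀ᶠ σ in 𝓝 t', σ < t' + δ := Iio_mem_nhds (by linarith)
      have e4 : ∀ᶠ σ in 𝓝 t', σ < T₁ := Iio_mem_nhds ht'T
      -- a good time slightly to the right of `t'`
      obtain ⟨ρ, hρ, hgood⟩ := Metric.eventually_nhds_iff.1 (e1.and (e2.and (e3.and e4)))
      have hρ' : 0 < min ρ (T₁ - t') := lt_min hρ (sub_pos.2 ht'T)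
      obtain ⟨σ, hσI, hσG⟩ := exists_mem_Ioo_of_ae_mem hGae (hr0.trans hrt').le
        (show t' < t' + min ρ (T₁ - t') / 2 by linarith)
        (by linarith [min_le_right ρ (T₁ - t')])
      have hσdist : dist σ t' < ρ := by
        rw [Real.dist_eq, abs_of_pos (sub_pos.2 hσI.1)]
        linarith [hσI.2, min_le_left ρ (T₁ - t')]
      obtain ⟨g1, g2, g3, g4⟩ := hgood hσdist
      have hvσ : v σ y = R r σ y := hC r hr σ hσG (hrt'.trans hσI.1) y
      -- the Duhamel increment between `t'` and `σ`
      have hduh : ‖oseenDuhamel 1 r v v σ y - oseenDuhamel 1 r v v t' y‖ ≤ ε / 3 :=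
        hmod (by linarith) (hmeasv hr0.le le_rfl) (hmeasv hr0.le le_rfl)
          (fun τ hτ z => hvL τ ⟨hr0.trans hτ.1, hτ.2⟩ z) (fun τ hτ z => hvL τ ⟨hr0.trans hτ.1, hτ.2⟩ z)
          hrt'.le hσI.1.le g4.le (by linarith [hσI.2, min_le_left ρ (T₁ - t')]) y
      have hRR : ‖R r σ y - R r t' y‖ ≤ ε / 3 + ε / 3 := by
        simp only [hRdef]
        calc _ = ‖(UnboundedOperators.heatExtension (v r) (σ - r) y -
              UnboundedOperators.heatExtension (v r) (t' - r) y) -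
            (oseenDuhamel 1 r v v σ y - oseenDuhamel 1 r v v t' y)‖ := by abel_nf
          _ ≤ ‖UnboundedOperators.heatExtension (v r) (σ - r) y -
              UnboundedOperators.heatExtension (v r) (t' - r) y‖ +
            ‖oseenDuhamel 1 r v v σ y - oseenDuhamel 1 r v v t' y‖ := norm_sub_le _ _
          _ ≤ ε / 3 + ε / 3 := add_le_add g2.le hduh
      have g1' : ‖v t' y - v σ y‖ ≤ ε / 3 := by rw [norm_sub_rev]; exact g1.le
      calc ‖v t' y - R r t' y‖ = ‖(v t' y - v σ y) + (R r σ y - R r t' y)‖ := by rw [hvσ]; abel_nf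
        _ ≤ ‖v t' y - v σ y‖ + ‖R r σ y - R r t' y‖ := norm_add_le _ _
        _ ≤ ε / 3 + (ε / 3 + ε / 3) := add_le_add g1' hRR
        _ = ε := by ring
    exact sub_eq_zero.1 hsub
  -- (b) any initial time
  have hE : ∀ r t' : ℝ, 0 < r → r < t' → t' < T₁ → ∀ y, v t' y = R r t' y := by
    intro r t' hr0 hrt' ht'T y
    have hsub : v t' y - R r t' y = 0 := by
      refine eq_zero_of_forall_norm_le fun ε hε => ?_
      have h1 : ContinuousAt (fun ρ => UnboundedOperators.heatExtension (v ρ) (t' - ρ) y) r :=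
        continuousAt_heatExtension_datum hcontv hvL hr0 (hrt'.trans ht'T) hrt' y
      have h2 : ContinuousAt (fun ρ => oseenDuhamel 1 ρ v v t' y) r :=
        continuousAt_oseenDuhamel_initialTime hcontv hL0 hvL hr0 hrt' ht'T.le y
      have hRc : ContinuousAt (fun ρ => R ρ t' y) r := h1.sub h2
      have e1 : ∀ᶠ ρ in 𝓝 r, ‖R ρ t' y - R r t' y‖ < ε := by
        have := (Metric.tendsto_nhds.1 hRc) ε hε
        simpa only [dist_eq_norm] using this
      obtain ⟨δ, hδ, hgood⟩ := Metric.eventually_nhds_iff.1 e1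
      have hδ' : 0 < min δ (t' - r) := lt_min hδ (sub_pos.2 hrt')
      obtain ⟨ρ, hρI, hρG⟩ := exists_mem_Ioo_of_ae_mem hGae hr0.le
        (show r < r + min δ (t' - r) / 2 by linarith) (by linarith [min_le_right δ (t' - r), ht'T])
      have hρdist : dist ρ r < δ := by
        rw [Real.dist_eq, abs_of_pos (sub_pos.2 hρI.1)]
        linarith [hρI.2, min_le_left δ (t' - r)]
      have hρt' : ρ < t' := by linarith [hρI.2, min_le_right δ (t' - r)]
      have hvρ : v t' y = R ρ t' y := hC' ρ hρG t' hρt' ht'T y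
      rw [hvρ]
      exact (hgood hρdist).le
    exact sub_eq_zero.1 hsub
  -- ### translate back
  have hr : 0 < s - a₁ := sub_pos.2 ha₁s
  have hrt : s - a₁ < t - a₁ := by linarith
  have htT₁ : t - a₁ < T₁ := by rw [hT₁]; linarith
  have key := hE (s - a₁) (t - a₁) hr hrt htT₁ x
  simp only [hRdef, hv, sub_add_cancel] at key
  rw [show t - a₁ - (s - a₁) = t - s by ring] at key
  rw [key, oseenDuhamel_translate 1 (s - a₁) a₁ u u (t - a₁) x, sub_add_cancel, sub_add_cancel]

end OpenWindow

/-! ### The discharge: the endpoint by continuity -/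

section Discharge

/-- **KNSS 2009, Theorem 6.1, mildness clause — discharged**: the named fact
`KNSS2009_mild_of_rMulNorm_bounded` holds. The open window `t < T` is
`mild_of_rMulNorm_bounded_of_lt`; the endpoint `t = T` follows by continuity in `t` of `u(t, x)`,
of the caloric term (`hasDerivAt_heatExtension_time`) and of the Duhamel term
(`exists_forall_norm_oseenDuhamel_sub_le`, which needs `u` bounded on `(s, T)` only). [cite: KochNadirashviliSereginSverak2009, Thm 6.1 (mildness clause), proof last paragraph (arXiv p. 12)] -/
theorem KNSS2009_mild_of_rMulNorm_bounded_holds : KNSS2009_mild_of_rMulNorm_bounded := by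
  intro a b T u p hcl haT hTb hL hD s t has hst htT x
  obtain ⟨L, hL⟩ := hL
  obtain ⟨D, hD⟩ := hD
  rcases htT.lt_or_eq with hlt | heq
  · exact mild_of_rMulNorm_bounded_of_lt hcl haT hTb hL hD has hst hlt x
  subst heq
  -- `t = T`: the endpoint by continuity
  have hL0 : 0 ≤ L := (norm_nonneg _).trans (hL t ⟨haT, le_rfl⟩ 0)
  have hcont : ContinuousOn (uncurry u) (Ioo a b ×ˢ univ) := hcl.smooth_velocity.continuousOn
  have hopen : ∀ σ ∈ Ioo s t, u σ x =
      UnboundedOperators.heatExtension (u s) (σ - s) x - oseenDuhamel 1 s u u σ x :=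
    fun σ hσ => mild_of_rMulNorm_bounded_of_lt hcl haT hTb hL hD has hσ.1 hσ.2 x
  have hsub : u t x - (UnboundedOperators.heatExtension (u s) (t - s) x - oseenDuhamel 1 s u u t x) = 0 := by
    refine eq_zero_of_forall_norm_le fun ε hε => ?_
    -- continuity of `u` in time at `(t, x)`
    have huc : ContinuousAt (fun σ => u σ x) t := by
      have hc : ContinuousAt (uncurry u) (t, x) :=
        hcont.continuousAt ((isOpen_Ioo.prod isOpen_univ).mem_nhds ⟨⟨haT, hTb⟩, mem_univ _⟩)
      have hg : ContinuousAt (fun σ : ℝ => (σ, x)) t :=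
        (continuous_id.prodMk continuous_const).continuousAt
      exact ContinuousAt.comp (g := uncurry u) (f := fun σ : ℝ => (σ, x)) hc hg
    have e1 : ∀ᶠ σ in 𝓝 t, ‖u σ x - u t x‖ < ε / 3 := by
      have := (Metric.tendsto_nhds.1 huc) (ε / 3) (by positivity)
      simpa only [dist_eq_norm] using this
    -- continuity of the caloric term in time
    have hsc : Continuous (u s) := (hcl.contDiff_velocity ⟨has, hst.trans hTb⟩).continuous
    have hsL : ∀ y, ‖u s y‖ ≤ L := fun y => hL s ⟨has, hst.le⟩ y
    have hcalc : ContinuousAt (fun σ => UnboundedOperators.heatExtension (u s) (σ - s) x) t := by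
      have hd := UnboundedOperators.hasDerivAt_heatExtension_time (sub_pos.2 hst)
        (UnboundedOperators.memLp_top_of_continuous_of_bound hsc hsL) le_top x
      have hg : ContinuousAt (fun σ : ℝ => σ - s) t := (continuous_id.sub continuous_const).continuousAt
      exact ContinuousAt.comp (g := fun σ => UnboundedOperators.heatExtension (u s) σ x)
        (f := fun σ : ℝ => σ - s) hd.continuousAt hg
    have e2 : ∀ᶠ σ in 𝓝 t, ‖UnboundedOperators.heatExtension (u s) (σ - s) x -
        UnboundedOperators.heatExtension (u s) (t - s) x‖ < ε / 3 := by
      have := (Metric.tendsto_nhds.1 hcalc) (ε / 3) (by positivity)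
      simpa only [dist_eq_norm] using this
    -- the Duhamel term: uniform modulus on the window `(s, t)`
    have hmeas : AEStronglyMeasurable (uncurry u)
        ((volume : Measure (ℝ × EuclideanSpace ℝ (Fin 3))).restrict (Ioo s t ×ˢ univ)) :=
      (hcont.mono (prod_mono (Ioo_subset_Ioo has.le hTb.le) subset_rfl)).aestronglyMeasurable
        (measurableSet_Ioo.prod MeasurableSet.univ)
    have hbd : ∀ τ ∈ Ioo s t, ∀ y, ‖u τ y‖ ≤ L := fun τ hτ y => hL τ ⟨has.trans hτ.1, hτ.2.le⟩ y
    obtain ⟨δ, hδ, hmod⟩ := exists_forall_norm_oseenDuhamel_sub_le (E := EuclideanSpace ℝ (Fin 3))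
      one_pos (sub_pos.2 hst) hL0 (by positivity : (0 : ℝ) < ε / 3)
    -- a time slightly to the left of `t`
    obtain ⟨ρ, hρ, hgood⟩ := Metric.eventually_nhds_iff.1 (e1.and e2)
    set m : ℝ := min (min ρ δ) (t - s) with hm
    have hm0 : 0 < m := lt_min (lt_min hρ hδ) (sub_pos.2 hst)
    set σ : ℝ := t - m / 2 with hσ
    have hσt : σ < t := by rw [hσ]; linarith
    have hsσ : s < σ := by
      rw [hσ]; linarith [min_le_right (min ρ δ) (t - s)]
    have hσdist : dist σ t < ρ := by
      rw [Real.dist_eq, hσ, show t - m / 2 - t = -(m / 2) by ring, abs_neg, abs_of_pos (by linarith)]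
      linarith [min_le_left (min ρ δ) (t - s), min_le_left ρ δ]
    have hσδ : t - σ ≤ δ := by
      rw [hσ]; linarith [min_le_left (min ρ δ) (t - s), min_le_right ρ δ]
    obtain ⟨g1, g2⟩ := hgood hσdist
    have hduh : ‖oseenDuhamel 1 s u u t x - oseenDuhamel 1 s u u σ x‖ ≤ ε / 3 :=
      hmod le_rfl hmeas hmeas hbd hbd hsσ.le hσt.le le_rfl hσδ x
    have huσ := hopen σ ⟨hsσ, hσt⟩
    calc ‖u t x - (UnboundedOperators.heatExtension (u s) (t - s) x - oseenDuhamel 1 s u u t x)‖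
        = ‖(u t x - u σ x) + ((UnboundedOperators.heatExtension (u s) (σ - s) x -
              UnboundedOperators.heatExtension (u s) (t - s) x) +
            (oseenDuhamel 1 s u u t x - oseenDuhamel 1 s u u σ x))‖ := by rw [huσ]; abel_nf
      _ ≤ ‖u t x - u σ x‖ + (‖UnboundedOperators.heatExtension (u s) (σ - s) x -
              UnboundedOperators.heatExtension (u s) (t - s) x‖ +
            ‖oseenDuhamel 1 s u u t x - oseenDuhamel 1 s u u σ x‖) :=
          (norm_add_le _ _).trans (add_le_add le_rfl (norm_add_le _ _))
      _ ≤ ε / 3 + (ε / 3 + ε / 3) :=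
          add_le_add (by rw [norm_sub_rev]; exact g1.le) (add_le_add g2.le hduh)
      _ = ε := by ring
  exact sub_eq_zero.1 hsub

/-- **KNSS 2009, proof of Theorem 6.2, the vertex estimate — discharged**: the named fact
`KNSS2009_typeI_rate_vertex` holds (the proved reduction `KNSS2009_typeI_rate_vertex_of_mild` fed
with the mildness clause `KNSS2009_mild_of_rMulNorm_bounded_holds`). [cite: KochNadirashviliSereginSverak2009, proof of Thm 6.2, last paragraph (arXiv p. 13)] -/
theorem KNSS2009_typeI_rate_vertex_holds : KNSS2009_typeI_rate_vertex :=
  KNSS2009_typeI_rate_vertex_of_mild KNSS2009_mild_of_rMulNorm_bounded_holds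

end Discharge


end Literature.Analysis.FluidPDE

end
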